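import Summits.QuantumFields.BalabanUV.Beta.SecondOrderBorderClassKit
import Summits.QuantumFields.BalabanUV.Beta.SecondOrderBorderGauge
import Summits.QuantumFields.BalabanUV.Beta.SymSecondOrderRemainderAn1
import Summits.QuantumFields.BalabanUV.Beta.SymSecondOrderClassStep

/-!
# `BalabanUV.Beta.SymSecondOrderClassBase` — binder row D1, hR side of the (0.4) ROOT: **THE BASE OF THE CLASS INDUCTION — the OWNER's
# level-0 remainder `symR2An1 … 0 α` (N11, `h0` solved for `R2 0`) IS A `LocStencil₂` FAMILY** at some positive rate, every `α`, `γ`, `cΛ`, `N`, `X2s`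
# (β sub-cell, D1 formalisation swarm, unit `b2b-balaban-beta-d1-formalise-leaf-03`, gen 17; the row-D1 OWNER an2's located ask R-D1-g32-6 (i)
# «iterated from a BASE `locStencil₂_symR2An1_zero` … please include the base», journal l.35328)

NOT IN PRINT; OUR BOOKKEEPING.  HONEST FRAMING (cell contract, verbatim): «discharging `BetaPertH` makes Bałaban's UV stability
UNCONDITIONAL — a real constructive-QFT result; it is NOT the continuum limit and NOT the Clay problem.»  HONEST DEPENDENCY (verbatim):
«continuum YM on T⁴ ⇐ BetaPertH ∧ nine spine estimates (0/9 proved); BetaPertH ⇐ (D1) ∧ (D4) ∧ CAP+tail; G-an2-4 gates asym, D1 and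
NE2/3/4.»  [folklore] exponential-localisation bookkeeping over OUR objects; instantiates NO binder of the β-function wall; no `[cite:]`, no `def`,
no `def … : Prop`; NOT D1, NOT `BetaPertH`, NOT continuum, NOT Clay.

## What

`SymSecondOrderRemainderAn1.symR2An1 Lc N cΛ γ X2s 0 α κ u κ′ u′` is, by definition (`h0` solved for `R2 0`),
`(ε_ακ ε_ακ′) • refK (Φ Lc α) (T2₀ κ (bref u) κ′ (bref u′)) − T2₀ κ u κ′ u′ − conjW 𝕄₀ (S₀ κ u) (S₀ κ′ u′) (D₀ κ u) (D₀ κ′ u′) (diagK (h2₀ κuκ′u′))`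
with `T2₀ := T2RecOf … 0` (an1's level-0 second-order table), `𝕄₀ := bhKStepSh 3 Lc (Dsh Lc) 0`, `S₀ := SpureRecOf … 0`, `D₀ κ u := diagK (γ_0·E_{κu})`,
`h2₀ := (γ_0·E_{κu})·(γ_0·E_{κ′u′})`.  The first summand is an2's reflection action `SecondOrderBorderGauge.actB Lc α T2₀` (same text), which
PRESERVES `LocStencil₂` (`SecondOrderBorderClassKit.locStencil₂_actB`); `T2₀` is `LocStencil₂` by `SpineRooted.T2RecOf_loc` over the (0.4) suppliers
((DG) `decays_Gsym`, (LS) `locStencil_SpureRecOf`, (LM) `vertexFamily_M1Of`, (LB) `locStencil₂_symVh₂SAn1`, (Lmix) `symMixFFAt_hmix_ctr`); the contact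
family is `LocStencil₂` by an2's `SecondOrderBorderClassKit.locStencil₂_conjW` over the classes of its letters (`S₀` local, the generator family
`SymSecondOrderSplitLoc.locStencil_diagK_mul_ctGenM`, the product symbol `SymSecondOrderSplitLoc.locStencil₂_diagK_ctGenM_mul_ctGenM`, `𝕄₀` decaying).
* §1 `locStencil₂_reflDefect` — generic: `κuκ′u′ ↦ actB N α T κuκ′u′ − T κuκ′u′ − W κuκ′u′` is `LocStencil₂` when `T`, `W` are (one common rate).
* §2 `locStencil₂_T2RecOf_symTablesAn1` — the (0.4) literal's `T2RecOf … j` is `LocStencil₂`, every `j` (`T2RecOf_loc` at the sym suppliers).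
* §3 **`locStencil₂_symR2An1_zero (N cΛ γ X2s α) : ∃ C δ, 0 < δ ∧ LocStencil₂ (symR2An1 Lc N cΛ γ X2s 0 α) C δ`** — THE BASE.
With `SymSecondOrderClassStep.locStencil₂_symR2An1_succ` (the step, R2-half) this is the R2-side of the class induction ROOT L's `hΔL` needs.
Provenance: β sub-cell, unit `b2b-balaban-beta-d1-formalise-leaf-03` gen 17, 2026-08-21 (v1); no existing file touched.
-/

noncomputable section

open Finset
open scoped BigOperators
open Literature.MathematicalPhysics.QuantumFieldTheory
open Literature.MathematicalPhysics.QuantumFieldTheory.Balaban1983to89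
open Literature.MathematicalPhysics.QuantumFieldTheory.Balaban1983to89.Beta
open B12Sec2to5 (l1 l1_nonneg)
open ExpKernelCalculus (MKer Decays BiLoc VertexFamily)
open PolarizationSign (reflSign)
open KernelReflection (refK)
open ResolventReflection (bref Φ)
open KernelWard (biLoc_add biLoc_sub)
open AveragingContoursRooted (ctr ctrOff ctrOff_mem_box)
open OneStepResolventKernel (Fib LocStencil biLoc_mono)
open BalabanCompositeJets (LocStencil₂)
open BalabanStepW2 (locStencil₂_smul' locStencil₂_add')
open WilsonVertex2Sym (wsym22)
open Summit.QuantumFields.BalabanUV.Beta.TameKernelCalculus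
open Summit.QuantumFields.BalabanUV.Beta.ChartConjugation (conjV conjW)
open Summit.QuantumFields.BalabanUV.Beta.AxialDressingRooted (one_le_of_neZero)
open Summit.QuantumFields.BalabanUV.Beta.BorderedHessian (bhK diagK spr_bhK)
open Summit.QuantumFields.BalabanUV.Beta.SecondOrderBorderGauge (actB)
open Summit.QuantumFields.BalabanUV.Beta.SecondOrderBorderClassKit (locStencil₂_actB locStencil₂_conjW)
open Summit.QuantumFields.BalabanUV.Beta.SymmetrisedStepJets (Gsym decays_Gsym)
open Summit.QuantumFields.BalabanUV.Beta.SpineRooted (M1Of SpureRecOf T2RecOf locStencil_SpureRecOf vertexFamily_M1Of T2RecOf_loc)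
open Summit.QuantumFields.BalabanUV.Beta.SymShiftedSpread (bhKStepSh spr_bhKStepSh)
open Summit.QuantumFields.BalabanUV.Beta.RelInvNullShift (spr_add)
open Summit.QuantumFields.BalabanUV.Beta.DshAn1 (Dsh spr_Dsh)
open Summit.QuantumFields.BalabanUV.Beta.E3ContactGenerator (ctGenM)
open Summit.QuantumFields.BalabanUV.Beta.SymAveragingHessianCounts (symVhSAt symHessFFAt symVhSAt_hV_ctr symHessFFAt_hH_ctr)
open Summit.QuantumFields.BalabanUV.Beta.SymAveragingMixedJetTables (symMixFFAt)
open Summit.QuantumFields.BalabanUV.Beta.SymSecondOrderTablesAn1 (symVh₂SAn1 locStencil₂_symVh₂SAn1 symMixFFAt_hmix_ctr)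
open Summit.QuantumFields.BalabanUV.Beta.SymSecondOrderSplitLoc (locStencil_diagK_mul_ctGenM locStencil₂_diagK_ctGenM_mul_ctGenM)
open Summit.QuantumFields.BalabanUV.Beta.SymSecondOrderRemainderAn1 (symR2An1)
open Summit.QuantumFields.BalabanUV.Beta.SymSecondOrderClassStep (pkg_of_spr)

namespace Summit.QuantumFields.BalabanUV.Beta.SymSecondOrderClassBase

variable {d : ℕ}

/-! ## §1 The reflection defect of a `LocStencil₂` table minus a `LocStencil₂` contact is `LocStencil₂` -/

/-- [folklore] **THE LEVEL-0 SHAPE**: for `N ≥ 1`, a `LocStencil₂` table `T` and a `LocStencil₂` family `W` at one rate `δ > 0`,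
`κuκ′u′ ↦ actB N α T κuκ′u′ − T κuκ′u′ − W κuκ′u′` is `LocStencil₂` at rate `δ` (`SecondOrderBorderClassKit.locStencil₂_actB` + algebra). -/
theorem locStencil₂_reflDefect {N : ℕ} (hN : 1 ≤ N) (α : Fin (d + 1))
    {T W : Fin (d + 1) → (Fin (d + 1) → ℤ) → Fin (d + 1) → (Fin (d + 1) → ℤ) → MKer (d + 1) (Fib d)} {CT CW δ : ℝ}
    (hT : LocStencil₂ T CT δ) (hW : LocStencil₂ W CW δ) (hδ : 0 < δ) :
    LocStencil₂ (fun κ u κ' u' => actB N α T κ u κ' u' - T κ u κ' u' - W κ u κ' u')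
      (|CT| * Real.exp (δ * (4 * N) + 4 * δ) + CT + CW) δ := by
  have hA := locStencil₂_actB hN α hT hδ.le
  intro κ u κ' u'
  show BiLoc (actB N α T κ u κ' u' - T κ u κ' u' - W κ u κ' u') u u ((|CT| * Real.exp (δ * (4 * N) + 4 * δ) + CT + CW) * Real.exp (-δ * l1 (u' - u))) δ
  have h := biLoc_sub (biLoc_sub (hA κ u κ' u') (hT κ u κ' u')) (hW κ u κ' u')
  rw [add_mul, add_mul]
  exact h

/-! ## §2 The (0.4) literal's second-order table `T2RecOf … j` is a `LocStencil₂` family -/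

section Literal

variable {Lc : ℕ} [NeZero Lc]

/-- [folklore] **`T2RecOf` OF THE (0.4) LITERAL IS `LocStencil₂`, EVERY LEVEL** — `SpineRooted.T2RecOf_loc` at the sym suppliers (DG)(LS)(LM)(LB)(Lmix)
(no `Odd Lc`, no lock). -/
theorem locStencil₂_T2RecOf_symTablesAn1 (N : ℕ) (cΛ : ℝ) :
    ∀ j : ℕ, ∃ C δ : ℝ, 0 < δ ∧ LocStencil₂
      (T2RecOf 3 Lc (Gsym Lc) (SpureRecOf 3 Lc (symVhSAt (ctr 4 Lc) 3 Lc rfl) (symHessFFAt (ctr 4 Lc) Lc) (Gsym Lc) ((Lc : ℝ) ^ 4) (-((Lc : ℝ) ^ 8 / 2)) cΛ)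
        (M1Of 3 Lc (symHessFFAt (ctr 4 Lc) Lc) cΛ) ((Lc : ℝ) ^ 8) (-((Lc : ℝ) ^ 12 / 4)) ((8 * (N : ℝ) ^ 2)⁻¹ • wsym22 N) (symVh₂SAn1 3 Lc)
        (symMixFFAt (ctr 4 Lc) Lc) j) C δ := by
  have hL1 : 1 ≤ Lc := one_le_of_neZero Lc
  obtain ⟨C1, hH1⟩ := symHessFFAt_hH_ctr (d := 3) hL1 1 zero_le_one
  exact T2RecOf_loc ((Lc : ℝ) ^ 8) (-((Lc : ℝ) ^ 12 / 4)) ((8 * (N : ℝ) ^ 2)⁻¹ • wsym22 N) (symVh₂SAn1 3 Lc) (symMixFFAt (ctr 4 Lc) Lc) hL1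
    (decays_Gsym Lc)
    (locStencil_SpureRecOf (d := 3) hL1 (symVhSAt_hV_ctr (d := 3) hL1) (symHessFFAt_hH_ctr (d := 3) hL1) (decays_Gsym Lc) _ _ cΛ)
    (fun j => ⟨_, 1, one_pos, vertexFamily_M1Of hH1 cΛ j⟩) (locStencil₂_symVh₂SAn1 hL1) (symMixFFAt_hmix_ctr hL1)

/-! ## §3 THE BASE: `symR2An1 … 0 α` is a `LocStencil₂` family -/

/-- [folklore] **THE BASE OF THE CLASS INDUCTION: the OWNER's level-0 remainder `symR2An1 Lc N cΛ γ X2s 0 α` is a `LocStencil₂` family** at some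
positive rate, for every `N`, `cΛ`, `γ`, `X2s`, `α` (the reflection action of the level-0 table, the table, and the level-0 contact family — all
`LocStencil₂` at a common rate; no `Odd Lc`, no lock, no letter). -/
theorem locStencil₂_symR2An1_zero (N : ℕ) (cΛ : ℝ) (γ : ℕ → ℝ)
    (X2s : ℕ → Fin 4 → Fin 4 → (Fin 4 → ℤ) → Fin 4 → (Fin 4 → ℤ) → (Fin 4 → ℤ) → Fib 3 → ℝ) (α : Fin 4) :
    ∃ C δ : ℝ, 0 < δ ∧ LocStencil₂ (symR2An1 Lc N cΛ γ X2s 0 α) C δ := by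
  have hL1 : 1 ≤ Lc := one_le_of_neZero Lc
  -- the level-0 table
  obtain ⟨CT, δT, hδT, hT⟩ := locStencil₂_T2RecOf_symTablesAn1 (Lc := Lc) N cΛ 0
  -- the letters of the contact family, at their own rates
  obtain ⟨δM, CM, hδM, hCM, hMd⟩ := pkg_of_spr (spr_bhKStepSh (d := 3) (Lc := Lc) (spr_Dsh hL1) 0)
  obtain ⟨δB, CB, hδB, hCB, hBd⟩ := pkg_of_spr (spr_add (spr_bhK (d := 3) hL1) (spr_Dsh hL1))
  obtain ⟨Cs, δs, hδs, hS⟩ := locStencil_SpureRecOf (d := 3) hL1 (symVhSAt_hV_ctr (d := 3) hL1) (symHessFFAt_hH_ctr (d := 3) hL1)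
    (decays_Gsym Lc) ((Lc : ℝ) ^ 4) (-((Lc : ℝ) ^ 8 / 2)) cΛ 0
  have hX := locStencil_diagK_mul_ctGenM hBd hδB.le (γ 0) α Lc
  have hX₂ := locStencil₂_diagK_ctGenM_mul_ctGenM hBd hδB.le (γ 0) (γ 0) α Lc
  -- one common rate
  set m : ℝ := min (min δT δM) (min δs (δB / 3)) with hm_def
  have hm : 0 < m := lt_min (lt_min hδT hδM) (lt_min hδs (by positivity))
  have hmT : m ≤ δT := (min_le_left _ _).trans (min_le_left _ _)
  have hmM : m ≤ δM := (min_le_left _ _).trans (min_le_right _ _)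
  have hms : m ≤ δs := (min_le_right _ _).trans (min_le_left _ _)
  have hmB3 : m ≤ δB / 3 := (min_le_right _ _).trans (min_le_right _ _)
  have hmB2 : m ≤ δB / 2 := hmB3.trans (by linarith)
  have hCs : 0 ≤ Cs := (hS 0 0).nonneg (Sum.inl 0)
  have hTm := hT.mono (m := m) hmT
  have hMm : Decays (bhKStepSh 3 Lc (Dsh Lc) 0) (|CM|) m := decays_of_le hMd hmM
  have hSm : LocStencil (SpureRecOf 3 Lc (symVhSAt (ctr 4 Lc) 3 Lc rfl) (symHessFFAt (ctr 4 Lc) Lc) (Gsym Lc) ((Lc : ℝ) ^ 4) (-((Lc : ℝ) ^ 8 / 2)) cΛ 0)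
      Cs m := fun κ u => biLoc_mono (hS κ u) hCs hms
  have hXm : LocStencil (fun κ u => diagK fun p a => γ 0 * ctGenM 3 (bhK Lc + Dsh Lc) α Lc κ u p a)
      (|(|γ 0| * (1 + ((Lc : ℝ) ^ (3 + 1))⁻¹ * CB))|) m := fun κ u => biLoc_of_le (hX κ u) hmB2
  have hX₂m := hX₂.mono (m := m) hmB3
  -- the contact family
  obtain ⟨CW, hW⟩ := locStencil₂_conjW hMm hSm hXm hX₂m hm
  -- assemble at rate m/8
  have h := locStencil₂_reflDefect (d := 3) hL1 α (hTm.mono (m := m / 8) (by linarith)) hW (by positivity)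
  have e : symR2An1 Lc N cΛ γ X2s 0 α = fun κ u κ' u' =>
      actB Lc α (T2RecOf 3 Lc (Gsym Lc) (SpureRecOf 3 Lc (symVhSAt (ctr 4 Lc) 3 Lc rfl) (symHessFFAt (ctr 4 Lc) Lc) (Gsym Lc) ((Lc : ℝ) ^ 4) (-((Lc : ℝ) ^ 8 / 2)) cΛ)
          (M1Of 3 Lc (symHessFFAt (ctr 4 Lc) Lc) cΛ) ((Lc : ℝ) ^ 8) (-((Lc : ℝ) ^ 12 / 4)) ((8 * (N : ℝ) ^ 2)⁻¹ • wsym22 N) (symVh₂SAn1 3 Lc)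
          (symMixFFAt (ctr 4 Lc) Lc) 0) κ u κ' u' -
        T2RecOf 3 Lc (Gsym Lc) (SpureRecOf 3 Lc (symVhSAt (ctr 4 Lc) 3 Lc rfl) (symHessFFAt (ctr 4 Lc) Lc) (Gsym Lc) ((Lc : ℝ) ^ 4) (-((Lc : ℝ) ^ 8 / 2)) cΛ)
          (M1Of 3 Lc (symHessFFAt (ctr 4 Lc) Lc) cΛ) ((Lc : ℝ) ^ 8) (-((Lc : ℝ) ^ 12 / 4)) ((8 * (N : ℝ) ^ 2)⁻¹ • wsym22 N) (symVh₂SAn1 3 Lc)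
          (symMixFFAt (ctr 4 Lc) Lc) 0 κ u κ' u' -
        conjW (bhKStepSh 3 Lc (Dsh Lc) 0)
          (SpureRecOf 3 Lc (symVhSAt (ctr 4 Lc) 3 Lc rfl) (symHessFFAt (ctr 4 Lc) Lc) (Gsym Lc) ((Lc : ℝ) ^ 4) (-((Lc : ℝ) ^ 8 / 2)) cΛ 0 κ u)
          (SpureRecOf 3 Lc (symVhSAt (ctr 4 Lc) 3 Lc rfl) (symHessFFAt (ctr 4 Lc) Lc) (Gsym Lc) ((Lc : ℝ) ^ 4) (-((Lc : ℝ) ^ 8 / 2)) cΛ 0 κ' u')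
          ((fun κ u => diagK fun p a => γ 0 * ctGenM 3 (bhK Lc + Dsh Lc) α Lc κ u p a) κ u)
          ((fun κ u => diagK fun p a => γ 0 * ctGenM 3 (bhK Lc + Dsh Lc) α Lc κ u p a) κ' u')
          ((fun κ u κ' u' => diagK fun p a => (γ 0 * ctGenM 3 (bhK Lc + Dsh Lc) α Lc κ u p a) * (γ 0 * ctGenM 3 (bhK Lc + Dsh Lc) α Lc κ' u' p a)) κ u κ' u') := by
    funext κ u κ' u'; rfl
  rw [e]
  exact ⟨_, m / 8, by positivity, h⟩

end Literal

end Summit.QuantumFields.BalabanUV.Beta.SymSecondOrderClassBase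

end
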